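/- EXTRA WIDTH seat `ym-line-cbag-p1-w5` (g11), LINE 7 `GlueballBandRecursion`, in support of ⟨stmt-QuantumFields-22957⟩
`OneParticleBlochSymbolFamily` (= `Band.EffectiveBlochSymbolFamily`): companion of `…SymbolRegularity` — attained supremum, volume
comparison and the lattice-angle bridge to the Bloch reduction, for the planner's stub S3 `stub_symbolRegularityUniform`
(STUB-PLAN 2026-08-28T18:17Z).  Route-independent (no `Theses` import); definition-free. -/
import Summits.QuantumFields.YangMills.Theorems.GlueballBandRecursionSymbolRegularity

/-!
# Route `GlueballBandRecursion`: trigonometric matrix symbols — supremum, comparison, lattice angles (stub S3 prefab, part 2)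

Continuing `…SymbolRegularity` (symbol `B̃(q) = Σ_y e^{−i q·w_y} J_y`, Rayleigh quotients `R_u(q) = Re⟪u, B̃(q) u⟫`):

* §5 (P3, first half) the supremum `Λ = sup_{q, ‖u‖=1} R_u(q)` of ANY continuous `2π`-periodic symbol is ATTAINED (compactness of
  `[0, 2π]³ × sphere`, reduction of `q` to the cell by `q ↦ q − 2π⌊q/2π⌋`), and the Rayleigh quotients of a trigonometric symbol are
  jointly continuous in `(q, u)`;
* §6 (P3, second half, reduced) volume stability of `log Λ`: `|log Λ − log Λ'| ≤ ε/r₀` as soon as the two families of quotients are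
  `ε`-close and `≥ r₀ > 0`; and `ε = Σ_y d_y` for two trigonometric symbols with the same hopping vectors and `‖⟪u,(J_y − J'_y)u⟫‖ ≤ d_y`
  (so the typed S3 only has to bound the kernel difference `J_N − J_∞`, which is where `D'/N` — in truth `e^{−cN}` — comes from);
* §7 the LATTICE-ANGLE BRIDGE to `…BlochReduction` (w4 g8, p657586): if the hopping vectors are integer representatives of the torus
  sites (`w_x ≡ x mod N`) and `J_x = M((x,·),(0,·))` is the first block column of a translation-invariant `M` on `(ℤ/N)³ × Fin n`,
  then `B̃(θ_p)` IS the Bloch symbol `B p` at every lattice angle `θ_p = latticeAngle N p`, hence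
  `Σ_p Re tr B̃(θ_p)^t = Re tr M^t` — the expression in field (P4) of `EffectiveBlochSymbolFamily`;
* §8 the PACKAGE: for symmetric, diagonally dominant trigonometric data the four N-local fields of `EffectiveBlochSymbolFamily`
  (Hermitian, periodic, (P1)∧(P2) with `K = M₂/r₀ + M₀M₂/r₀²`, (P3) attained `Λ`) hold — leaving to the typed stub S3 only the
  production of the kernel (S1) and the two-sided trace control (S4).

Sources: folklore (compactness; discrete Fourier analysis).  HONEST FRAMING.  Calculus and finite-dimensional linear algebra only.
Neither item 22957, nor the rung `ColdDoublingRecursionStrongCoupling`, nor the Yang–Mills mass gap is proved or advanced here.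
-/

set_option autoImplicit false

noncomputable section

open Finset Complex
open scoped InnerProductSpace Real ComplexConjugate Matrix

namespace Summit.QuantumFields.YangMills.Theorems.GlueballBandRecursion.Symbol

open Summit.QuantumFields.YangMills.Theorems.GlueballBandRecursion.Band (coordsF latticeAngle)

variable {ι : Type*} [Fintype ι] {n : ℕ}

/-! ## §5 Continuity and the attained supremum -/

section MatrixSymbol

variable (w : ι → Fin 3 → ℤ) (J : ι → Matrix (Fin n) (Fin n) ℂ) (Bt : (Fin 3 → ℝ) → Matrix (Fin n) (Fin n) ℂ)
  (hBt : ∀ q, Bt q = ∑ y, cexp (((-(∑ i, q i * (w y i : ℝ)) : ℝ) : ℂ) * I) • J y)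
include hBt

/-- The Rayleigh quotients `(q, u) ↦ Re⟪u, B̃(q) u⟫` of a trigonometric symbol are jointly continuous. [folklore] -/
theorem continuous_re_inner_symbol :
    Continuous fun qu : (Fin 3 → ℝ) × EuclideanSpace ℂ (Fin n) =>
      RCLike.re ⟪qu.2, Matrix.toEuclideanLin (Bt qu.1) qu.2⟫_ℂ := by
  have h : (fun qu : (Fin 3 → ℝ) × EuclideanSpace ℂ (Fin n) => RCLike.re ⟪qu.2, Matrix.toEuclideanLin (Bt qu.1) qu.2⟫_ℂ) =
      fun qu => (∑ y, ⟪qu.2, Matrix.toEuclideanLin (J y) qu.2⟫_ℂ *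
        cexp (((-(∑ i, qu.1 i * (w y i : ℝ)) : ℝ) : ℂ) * I)).re :=
    funext fun qu => re_inner_symbol w J Bt hBt qu.2 qu.1
  rw [h]
  refine Complex.continuous_re.comp (continuous_finsetSum _ fun y _ => Continuous.mul ?_ ?_)
  · exact continuous_snd.inner ((Matrix.toEuclideanLin (J y)).continuous_of_finiteDimensional.comp continuous_snd)
  · refine Complex.continuous_exp.comp ((Complex.continuous_ofReal.comp ?_).mul continuous_const)
    exact (continuous_finsetSum _ fun i _ => ((continuous_apply i).comp continuous_fst).mul continuous_const).neg

end MatrixSymbol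

/-- **(P3, attained supremum)**: for ANY symbol whose Rayleigh quotients are jointly continuous and which is `2π`-periodic, the
supremum `Λ` of `Re⟪u, B̃(q) u⟫` over `q ∈ ℝ³`, `‖u‖ = 1` is attained (`n ≥ 1`) — the shape of the third field of
`EffectiveBlochSymbolFamily`. [folklore] -/
theorem exists_rayleigh_sup_attained (hn : 0 < n) (Bt : (Fin 3 → ℝ) → Matrix (Fin n) (Fin n) ℂ)
    (hcont : Continuous fun qu : (Fin 3 → ℝ) × EuclideanSpace ℂ (Fin n) =>
      RCLike.re ⟪qu.2, Matrix.toEuclideanLin (Bt qu.1) qu.2⟫_ℂ)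
    (hper : ∀ (q : Fin 3 → ℝ) (z : Fin 3 → ℤ), Bt (fun i => q i + 2 * π * z i) = Bt q) :
    ∃ (Λ : ℝ) (qs : Fin 3 → ℝ) (us : EuclideanSpace ℂ (Fin n)), ‖us‖ = 1 ∧
      RCLike.re ⟪us, Matrix.toEuclideanLin (Bt qs) us⟫_ℂ = Λ ∧
      ∀ (q : Fin 3 → ℝ) (u : EuclideanSpace ℂ (Fin n)), ‖u‖ = 1 →
        RCLike.re ⟪u, Matrix.toEuclideanLin (Bt q) u⟫_ℂ ≤ Λ := by
  obtain ⟨F, hF⟩ : ∃ F : (Fin 3 → ℝ) × EuclideanSpace ℂ (Fin n) → ℝ,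
      ∀ qu, F qu = RCLike.re ⟪qu.2, Matrix.toEuclideanLin (Bt qu.1) qu.2⟫_ℂ := ⟨_, fun _ => rfl⟩
  have hFc : Continuous F := by
    have : F = fun qu => RCLike.re ⟪qu.2, Matrix.toEuclideanLin (Bt qu.1) qu.2⟫_ℂ := funext hF
    rw [this]
    exact hcont
  obtain ⟨S, hS⟩ : ∃ S : Set ((Fin 3 → ℝ) × EuclideanSpace ℂ (Fin n)),
      S = Set.Icc (0 : Fin 3 → ℝ) (fun _ => 2 * π) ×ˢ Metric.sphere (0 : EuclideanSpace ℂ (Fin n)) 1 := ⟨_, rfl⟩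
  have hSc : IsCompact S := hS ▸ isCompact_Icc.prod (isCompact_sphere _ _)
  have h2π : (0 : ℝ) ≤ 2 * π := by positivity
  have hSne : S.Nonempty := by
    refine ⟨(0, EuclideanSpace.single (⟨0, hn⟩ : Fin n) (1 : ℂ)), ?_⟩
    rw [hS]
    exact ⟨⟨le_rfl, fun _ => h2π⟩, by simp⟩
  obtain ⟨⟨qs, us⟩, hmem, hmax⟩ := hSc.exists_isMaxOn hSne hFc.continuousOn
  rw [hS] at hmem
  have hus : ‖us‖ = 1 := by simpa using hmem.2
  refine ⟨F (qs, us), qs, us, hus, (hF (qs, us)).symm, fun q u hu => ?_⟩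
  -- reduce `q` to the fundamental cell `[0, 2π]³`
  obtain ⟨z, hz⟩ : ∃ z : Fin 3 → ℤ, ∀ i, z i = -⌊q i / (2 * π)⌋ := ⟨_, fun _ => rfl⟩
  have h2π' : (0 : ℝ) < 2 * π := by positivity
  have hq'mem : (fun i => q i + 2 * π * (z i : ℝ)) ∈ Set.Icc (0 : Fin 3 → ℝ) (fun _ => 2 * π) := by
    refine ⟨fun i => ?_, fun i => ?_⟩
    · have h1 : (⌊q i / (2 * π)⌋ : ℝ) ≤ q i / (2 * π) := Int.floor_le _
      rw [le_div_iff₀ h2π'] at h1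
      simp only [hz, Int.cast_neg, Pi.zero_apply]
      nlinarith
    · have h1 : q i / (2 * π) < (⌊q i / (2 * π)⌋ : ℝ) + 1 := Int.lt_floor_add_one _
      rw [div_lt_iff₀ h2π'] at h1
      simp only [hz, Int.cast_neg]
      nlinarith
  have hmem' : ((fun i => q i + 2 * π * (z i : ℝ)), u) ∈ S := by
    rw [hS]
    exact ⟨hq'mem, by simpa using hu⟩
  have hle : F ((fun i => q i + 2 * π * (z i : ℝ)), u) ≤ F (qs, us) := hmax hmem'
  rw [hF, hF] at hle
  simp only [hper q z] at hle
  rw [hF]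
  exact hle

/-! ## §6 Volume comparison of the band top (the `D'/N` clause, reduced to kernel closeness) -/

/-- `|log Λ − log Λ'| ≤ ε/r₀` when `Λ, Λ' ≥ r₀ > 0` are `ε`-close. [folklore] -/
theorem abs_log_sub_log_le_div {Λ Λ' ε r₀ : ℝ} (hr₀ : 0 < r₀) (hΛ : r₀ ≤ Λ) (hΛ' : r₀ ≤ Λ') (h1 : Λ ≤ Λ' + ε)
    (h2 : Λ' ≤ Λ + ε) : |Real.log Λ - Real.log Λ'| ≤ ε / r₀ := by
  have hΛp : 0 < Λ := hr₀.trans_le hΛ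
  have hΛp' : 0 < Λ' := hr₀.trans_le hΛ'
  have hε : 0 ≤ ε := by linarith
  have key : ∀ {a b : ℝ}, r₀ ≤ a → r₀ ≤ b → a ≤ b + ε → Real.log a - Real.log b ≤ ε / r₀ := by
    intro a b ha hb hab
    have hap : 0 < a := hr₀.trans_le ha
    have hbp : 0 < b := hr₀.trans_le hb
    have h3 : Real.log a ≤ Real.log (b + ε) := Real.log_le_log hap hab
    have h4 : Real.log (b + ε) - Real.log b = Real.log ((b + ε) / b) := (Real.log_div (by linarith) hbp.ne').symm
    have h5 : Real.log ((b + ε) / b) ≤ (b + ε) / b - 1 := Real.log_le_sub_one_of_pos (by positivity)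
    have h6 : (b + ε) / b - 1 = ε / b := by rw [div_sub_one hbp.ne', add_sub_cancel_left]
    have h7 : ε / b ≤ ε / r₀ := div_le_div_of_nonneg_left hε hr₀ hb
    linarith
  rw [abs_sub_le_iff]
  exact ⟨key hΛ hΛ' h1, key hΛ' hΛ h2⟩

/-- **Volume stability of `log Λ`, reduced**: if the Rayleigh quotients of two symbols are `≥ r₀ > 0` and `ε`-close uniformly in
`(q, u)`, their attained suprema satisfy `|log Λ − log Λ'| ≤ ε/r₀` (feed `Λ = Λ_N`, `Λ' = e^ℓ` realised by the infinite-volume symbol,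
`ε = O(1/N)` or better). [folklore] -/
theorem abs_log_sup_sub_log_sup_le {Bt Bt' : (Fin 3 → ℝ) → Matrix (Fin n) (Fin n) ℂ} {Λ Λ' ε r₀ : ℝ} (hr₀ : 0 < r₀)
    (hΛ : ∃ (qs : Fin 3 → ℝ) (us : EuclideanSpace ℂ (Fin n)), ‖us‖ = 1 ∧
      RCLike.re ⟪us, Matrix.toEuclideanLin (Bt qs) us⟫_ℂ = Λ)
    (hle : ∀ (q : Fin 3 → ℝ) (u : EuclideanSpace ℂ (Fin n)), ‖u‖ = 1 →
      RCLike.re ⟪u, Matrix.toEuclideanLin (Bt q) u⟫_ℂ ≤ Λ)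
    (hΛ' : ∃ (qs : Fin 3 → ℝ) (us : EuclideanSpace ℂ (Fin n)), ‖us‖ = 1 ∧
      RCLike.re ⟪us, Matrix.toEuclideanLin (Bt' qs) us⟫_ℂ = Λ')
    (hle' : ∀ (q : Fin 3 → ℝ) (u : EuclideanSpace ℂ (Fin n)), ‖u‖ = 1 →
      RCLike.re ⟪u, Matrix.toEuclideanLin (Bt' q) u⟫_ℂ ≤ Λ')
    (hpos : ∀ (q : Fin 3 → ℝ) (u : EuclideanSpace ℂ (Fin n)), ‖u‖ = 1 →
      r₀ ≤ RCLike.re ⟪u, Matrix.toEuclideanLin (Bt q) u⟫_ℂ)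
    (hpos' : ∀ (q : Fin 3 → ℝ) (u : EuclideanSpace ℂ (Fin n)), ‖u‖ = 1 →
      r₀ ≤ RCLike.re ⟪u, Matrix.toEuclideanLin (Bt' q) u⟫_ℂ)
    (hε : ∀ (q : Fin 3 → ℝ) (u : EuclideanSpace ℂ (Fin n)), ‖u‖ = 1 →
      |RCLike.re ⟪u, Matrix.toEuclideanLin (Bt q) u⟫_ℂ - RCLike.re ⟪u, Matrix.toEuclideanLin (Bt' q) u⟫_ℂ| ≤ ε) :
    |Real.log Λ - Real.log Λ'| ≤ ε / r₀ := by
  obtain ⟨qs, us, hus, hq⟩ := hΛ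
  obtain ⟨qs', us', hus', hq'⟩ := hΛ'
  have h1 := abs_sub_le_iff.1 (hε qs us hus)
  have h2 := abs_sub_le_iff.1 (hε qs' us' hus')
  refine abs_log_sub_log_le_div hr₀ (hq ▸ hpos qs us hus) (hq' ▸ hpos' qs' us' hus') ?_ ?_
  · linarith [hle' qs us hus]
  · linarith [hle qs' us' hus']

section TwoSymbols

variable (w : ι → Fin 3 → ℤ) (J J' : ι → Matrix (Fin n) (Fin n) ℂ) (Bt Bt' : (Fin 3 → ℝ) → Matrix (Fin n) (Fin n) ℂ)
  (hBt : ∀ q, Bt q = ∑ y, cexp (((-(∑ i, q i * (w y i : ℝ)) : ℝ) : ℂ) * I) • J y)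
  (hBt' : ∀ q, Bt' q = ∑ y, cexp (((-(∑ i, q i * (w y i : ℝ)) : ℝ) : ℂ) * I) • J' y)
include hBt hBt'

/-- **Kernel closeness ⇒ quotient closeness**: two trigonometric symbols with the same hopping vectors and
`‖⟪u, (J_y − J'_y) u⟫‖ ≤ d_y` have Rayleigh quotients within `Σ_y d_y` of each other, uniformly in `(q, u)`. [folklore] -/
theorem abs_re_inner_symbol_sub_le {d : ι → ℝ}
    (hd : ∀ u : EuclideanSpace ℂ (Fin n), ‖u‖ = 1 → ∀ y, ‖⟪u, Matrix.toEuclideanLin (J y - J' y) u⟫_ℂ‖ ≤ d y)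
    (u : EuclideanSpace ℂ (Fin n)) (hu : ‖u‖ = 1) (q : Fin 3 → ℝ) :
    |RCLike.re ⟪u, Matrix.toEuclideanLin (Bt q) u⟫_ℂ - RCLike.re ⟪u, Matrix.toEuclideanLin (Bt' q) u⟫_ℂ| ≤ ∑ y, d y := by
  rw [re_inner_symbol w J Bt hBt u q, re_inner_symbol w J' Bt' hBt' u q, ← Complex.sub_re, ← Finset.sum_sub_distrib]
  refine (Complex.abs_re_le_norm _).trans ((norm_sum_le _ _).trans (Finset.sum_le_sum fun y _ => ?_))
  rw [← sub_mul, norm_mul, Complex.norm_exp_ofReal_mul_I, mul_one, ← inner_sub_right, ← LinearMap.sub_apply, ← map_sub]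
  exact hd u hu y

end TwoSymbols

/-! ## §7 The lattice-angle bridge to the Bloch reduction -/

section Lattice

variable {N : ℕ} [NeZero N]

/-- At a lattice angle `θ_p` and for integer representatives `w_x ≡ x (mod N)` of the torus sites, the phase `e^{−i θ_p·w_x}` is the
conjugate torus character `conj χ_p(x)` of `…BlochReduction`. [folklore] -/
theorem phase_latticeAngle (w : (Fin N × Fin N × Fin N) → Fin 3 → ℤ)
    (hw : ∀ x i, ∃ m : ℤ, w x i = ((coordsF x i).val : ℤ) + (N : ℤ) * m) (p x : Fin N × Fin N × Fin N) :
    cexp (((-(∑ i, latticeAngle N p i * (w x i : ℝ)) : ℝ) : ℂ) * I) =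
      star (cexp (((∑ i : Fin 3, latticeAngle N p i * ((coordsF x i).val : ℝ) : ℝ) : ℂ) * I)) := by
  have h1 : star (cexp (((∑ i : Fin 3, latticeAngle N p i * ((coordsF x i).val : ℝ) : ℝ) : ℂ) * I)) =
      cexp (((-(∑ i : Fin 3, latticeAngle N p i * ((coordsF x i).val : ℝ)) : ℝ) : ℂ) * I) := by
    change conj (cexp _) = _
    rw [← Complex.exp_conj, map_mul, Complex.conj_ofReal, Complex.conj_I]
    congr 1
    push_cast
    ring
  rw [h1]
  choose m hm using hw
  have hN : (N : ℝ) ≠ 0 := by exact_mod_cast NeZero.ne N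
  have hk : ∑ i, latticeAngle N p i * (w x i : ℝ) =
      ∑ i, latticeAngle N p i * ((coordsF x i).val : ℝ) + 2 * π * ((∑ i, ((coordsF p i).val : ℤ) * m x i : ℤ) : ℝ) := by
    push_cast
    rw [Finset.mul_sum, ← Finset.sum_add_distrib]
    refine Finset.sum_congr rfl fun i _ => ?_
    rw [hm x i]
    push_cast
    simp only [latticeAngle]
    field_simp
  rw [hk, neg_add, Complex.ofReal_add, add_mul, Complex.exp_add]
  have h2 : cexp (((-(2 * π * ((∑ i, ((coordsF p i).val : ℤ) * m x i : ℤ) : ℝ)) : ℝ) : ℂ) * I) = 1 := by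
    have := Complex.exp_int_mul_two_pi_mul_I (-(∑ i, ((coordsF p i).val : ℤ) * m x i))
    rw [← this]
    congr 1
    push_cast
    ring
  rw [h2, mul_one]

variable (M : Matrix ((Fin N × Fin N × Fin N) × Fin n) ((Fin N × Fin N × Fin N) × Fin n) ℂ)
  (w : (Fin N × Fin N × Fin N) → Fin 3 → ℤ) (hw : ∀ x i, ∃ m : ℤ, w x i = ((coordsF x i).val : ℤ) + (N : ℤ) * m)
  (J : (Fin N × Fin N × Fin N) → Matrix (Fin n) (Fin n) ℂ) (hJ : ∀ x j k, J x j k = M (x, j) (0, k))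
  (Bt : (Fin 3 → ℝ) → Matrix (Fin n) (Fin n) ℂ)
  (hBt : ∀ q, Bt q = ∑ x, cexp (((-(∑ i, q i * (w x i : ℝ)) : ℝ) : ℂ) * I) • J x)
include hw hJ hBt

/-- **The interpolating symbol IS the Bloch symbol at lattice angles**: with hopping vectors `w_x ≡ x (mod N)` and hopping matrices
`J_x = M((x,·),(0,·))` (first block column of a matrix `M` on `(ℤ/N)³ × Fin n`),
`B̃(θ_p)_{jk} = Σ_x M((x,j),(0,k)) conj χ_p(x)` — the symbol `B p` of `…BlochReduction` (its hypothesis `hB`). [folklore] -/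
theorem symbol_latticeAngle_apply (p : Fin N × Fin N × Fin N) (j k : Fin n) :
    Bt (latticeAngle N p) j k =
      ∑ x, M (x, j) (0, k) * star (cexp (((∑ i : Fin 3, latticeAngle N p i * ((coordsF x i).val : ℝ) : ℝ) : ℂ) * I)) := by
  rw [hBt, Matrix.sum_apply]
  refine Finset.sum_congr rfl fun x _ => ?_
  rw [Matrix.smul_apply, smul_eq_mul, phase_latticeAngle w hw, hJ, mul_comm]

include hw hJ hBt in
/-- **The (P4) expression is a trace**: for translation-invariant `M` (`M((x+a,j),(y+a,k)) = M((x,j),(y,k))`) and the interpolating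
symbol of its first block column, `Σ_p Re tr B̃(θ_p)^t = Re tr M^t` for every `t` — by w4's trace formula
`Bloch.trace_pow_eq_sum_trace_symbol_pow` (p657586).  (With `M` = the band block of the transfer matrix in a translation-covariant
orthonormal frame, the right-hand side is `Σ_band (μ/λ₀)^t`, which the landed `sum_pow_div_le_traceExcess` compares with the thermal
trace excess.) [folklore] -/
theorem sum_re_trace_symbol_pow_eq (hM : ∀ a x y j k, M (x + a, j) (y + a, k) = M (x, j) (y, k)) (t : ℕ) :
    ∑ p : Fin N × Fin N × Fin N, ((Bt (latticeAngle N p) ^ t).trace).re = ((M ^ t).trace).re := by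
  obtain ⟨χ, hχ⟩ : ∃ χ : (Fin N × Fin N × Fin N) → (Fin N × Fin N × Fin N) → ℂ,
      ∀ p x, χ p x = cexp (((∑ i : Fin 3, latticeAngle N p i * ((coordsF x i).val : ℝ) : ℝ) : ℂ) * I) :=
    ⟨_, fun _ _ => rfl⟩
  obtain ⟨B, hB⟩ : ∃ B : (Fin N × Fin N × Fin N) → Matrix (Fin n) (Fin n) ℂ,
      ∀ p j k, B p j k = ∑ x, M (x, j) (0, k) * star (χ p x) :=
    ⟨fun p => Matrix.of fun j k => ∑ x, M (x, j) (0, k) * star (χ p x), fun _ _ _ => rfl⟩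
  obtain ⟨F, hF⟩ : ∃ F : Matrix ((Fin N × Fin N × Fin N) × Fin n) (Fin n × (Fin N × Fin N × Fin N)) ℂ,
      ∀ x j k p, F (x, j) (k, p) = if j = k then χ p x else 0 :=
    ⟨Matrix.of fun a b => if a.2 = b.1 then χ b.2 a.1 else 0, fun _ _ _ _ => rfl⟩
  have htr := Bloch.trace_pow_eq_sum_trace_symbol_pow χ hχ M hM B hB F hF t
  have hBt' : ∀ p, Bt (latticeAngle N p) = B p := fun p =>
    Matrix.ext fun j k => by rw [symbol_latticeAngle_apply M w hw J hJ Bt hBt p j k, hB]; simp only [hχ]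
  rw [htr, Complex.re_sum]
  exact Finset.sum_congr rfl fun p _ => by rw [hBt']

end Lattice

/-- **On-site term of rest-mass form**: for `J_{y₀} = c·1 + E` (`c` real) and a unit vector `u`,
`Re⟪u, J_{y₀} u⟫ ≥ c − Σ_{jk} ‖E_{jk}‖` — the diagonal-dominance input of `le_re_inner_symbol_of_dominant` in the shape a cluster
expansion delivers it (rest mass times identity plus small corrections). [folklore] -/
theorem sub_le_re_inner_smul_one_add (c : ℝ) (E : Matrix (Fin n) (Fin n) ℂ) (u : EuclideanSpace ℂ (Fin n)) (hu : ‖u‖ = 1) :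
    c - ∑ j, ∑ k, ‖E j k‖ ≤ RCLike.re ⟪u, Matrix.toEuclideanLin ((c : ℂ) • (1 : Matrix (Fin n) (Fin n) ℂ) + E) u⟫_ℂ := by
  rw [map_add, LinearMap.add_apply, inner_add_right, map_add, map_smul, LinearMap.smul_apply, inner_smul_right]
  have h1 : Matrix.toEuclideanLin (1 : Matrix (Fin n) (Fin n) ℂ) u = u := by
    rw [Matrix.toLpLin_one, LinearMap.id_apply]
  have h2 : RCLike.re ((c : ℂ) * ⟪u, Matrix.toEuclideanLin (1 : Matrix (Fin n) (Fin n) ℂ) u⟫_ℂ) = c := by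
    rw [h1]
    have h21 : RCLike.re ((c : ℂ) * ⟪u, u⟫_ℂ) = c * RCLike.re ⟪u, u⟫_ℂ := Complex.re_ofReal_mul c _
    rw [h21, ← norm_sq_eq_re_inner, hu, one_pow, mul_one]
  rw [h2]
  have h3 := Complex.abs_re_le_norm ⟪u, Matrix.toEuclideanLin E u⟫_ℂ
  have h4 := norm_inner_toEuclideanLin_le E u hu
  have h5 : RCLike.re ⟪u, Matrix.toEuclideanLin E u⟫_ℂ = (⟪u, Matrix.toEuclideanLin E u⟫_ℂ).re := rfl
  linarith [(abs_le.1 h3).1]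

/-! ## §8 The package: the N-local fields of `EffectiveBlochSymbolFamily` for symmetric dominant trigonometric data -/

/-- **S3 prefab, packaged.**  Let `B̃(q) = Σ_y e^{−i q·w_y} J_y` (`n ≥ 1`) be a finite trigonometric matrix symbol with
SYMMETRIC data (`w_{σy} = −w_y`, `J_{σy} = J_yᴴ` for an index symmetry `σ`), a quadratic-form majorant `‖⟪u, J_y u⟫‖ ≤ a_y`
(`‖u‖ = 1`), and a DOMINANT on-site term `y₀` (`w_{y₀} = 0`, `Re⟪u, J_{y₀} u⟫ ≥ r₀ + Σ_{y≠y₀} a_y`, `r₀ > 0`).  Then, literally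
as in the non-escape branch of `Band.EffectiveBlochSymbolFamily` (per `N`): `B̃` is Hermitian; `2π`-periodic; every Rayleigh quotient
of a unit vector is positive and log-C² with `K = M₂/r₀ + M₀M₂/r₀²` (`M₀ = Σ_y a_y`, `M₂ = Σ_y a_y|w_y|²`); and the supremum `Λ`
is attained.  What remains for the typed stub S3: `|log Λ_N − ℓ| ≤ D'/N` (§6) — and, upstream, the kernel itself (S1) and the trace
control (S4, §7). [folklore] -/
theorem symbol_package [DecidableEq ι] (hn : 0 < n) (w : ι → Fin 3 → ℤ) (J : ι → Matrix (Fin n) (Fin n) ℂ)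
    (Bt : (Fin 3 → ℝ) → Matrix (Fin n) (Fin n) ℂ)
    (hBt : ∀ q, Bt q = ∑ y, cexp (((-(∑ i, q i * (w y i : ℝ)) : ℝ) : ℂ) * I) • J y)
    (σ : ι ≃ ι) (hwσ : ∀ y, w (σ y) = -w y) (hJσ : ∀ y, J (σ y) = (J y)ᴴ)
    {a : ι → ℝ} (ha : ∀ u : EuclideanSpace ℂ (Fin n), ‖u‖ = 1 → ∀ y, ‖⟪u, Matrix.toEuclideanLin (J y) u⟫_ℂ‖ ≤ a y)
    (y₀ : ι) (hw₀ : w y₀ = 0) {r₀ : ℝ} (hr₀ : 0 < r₀)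
    (hdom : ∀ u : EuclideanSpace ℂ (Fin n), ‖u‖ = 1 →
      r₀ + ∑ y ∈ univ.erase y₀, a y ≤ RCLike.re ⟪u, Matrix.toEuclideanLin (J y₀) u⟫_ℂ) :
    (∀ q, (Bt q).IsHermitian) ∧
    (∀ (q : Fin 3 → ℝ) (z : Fin 3 → ℤ), Bt (fun i => q i + 2 * Real.pi * z i) = Bt q) ∧
    (∀ u : EuclideanSpace ℂ (Fin n), ‖u‖ = 1 →
      (∀ q, 0 < RCLike.re ⟪u, Matrix.toEuclideanLin (Bt q) u⟫_ℂ) ∧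
      ∀ x v : Fin 3 → ℝ,
        2 * Real.log (RCLike.re ⟪u, Matrix.toEuclideanLin (Bt x) u⟫_ℂ) -
            ((∑ y, a y * ∑ i, (w y i : ℝ) ^ 2) / r₀ + (∑ y, a y) * (∑ y, a y * ∑ i, (w y i : ℝ) ^ 2) / r₀ ^ 2) *
              ∑ i, v i ^ 2 ≤
          Real.log (RCLike.re ⟪u, Matrix.toEuclideanLin (Bt (x + v)) u⟫_ℂ) +
            Real.log (RCLike.re ⟪u, Matrix.toEuclideanLin (Bt (x - v)) u⟫_ℂ)) ∧
    (∃ (Λ : ℝ) (qs : Fin 3 → ℝ) (us : EuclideanSpace ℂ (Fin n)), ‖us‖ = 1 ∧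
      RCLike.re ⟪us, Matrix.toEuclideanLin (Bt qs) us⟫_ℂ = Λ ∧
      ∀ (q : Fin 3 → ℝ) (u : EuclideanSpace ℂ (Fin n)), ‖u‖ = 1 →
        RCLike.re ⟪u, Matrix.toEuclideanLin (Bt q) u⟫_ℂ ≤ Λ) := by
  have hpos : ∀ u : EuclideanSpace ℂ (Fin n), ‖u‖ = 1 → ∀ q, r₀ ≤ RCLike.re ⟪u, Matrix.toEuclideanLin (Bt q) u⟫_ℂ :=
    fun u hu q => le_re_inner_symbol_of_dominant w J Bt hBt y₀ hw₀ ha hdom u hu q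
  refine ⟨symbol_isHermitian w J Bt hBt σ hwσ hJσ, symbol_periodic w J Bt hBt, fun u hu => ⟨fun q => ?_, fun x v => ?_⟩, ?_⟩
  · exact hr₀.trans_le (hpos u hu q)
  · exact symbol_logC2 w J Bt hBt ha hr₀ hpos u hu x v
  · exact exists_rayleigh_sup_attained hn Bt (continuous_re_inner_symbol w J Bt hBt) (symbol_periodic w J Bt hBt)

end Summit.QuantumFields.YangMills.Theorems.GlueballBandRecursion.Symbol

end
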